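import Literature.Probability.Percolation.TwoSetConditionalAssociationRCSplitVertex
import HarnessLib

/-!
# `NoHeavyLowerTail` (stmt-CriticalPhenomena-4575) — the BHK row for the random-cluster measure `φ_{𝐩,q}`, every `q ≥ 1`

Support file (prover prim-gen-kcluster gen 48; `--supports stmt-CriticalPhenomena-4575`).  No named facts, no sorries,
no definitions.  The three-point "BHK row" of the lineage's cubic-law programme (KCLUSTER-gen43/44/46: `q · T_a ≤ u_b · u_c`,
kernel at `q = 1` as `PivotalBHK.bhkRow_PrW` / `bhkRow_prodBernoulli`, conjectured for every `q > 0` as "BHK-q" with an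
exact census on both sides of `q = 1`) is PROVED here for EVERY random-cluster measure `φ = rcMeasureW w q ∅` with `q ≥ 1`
(free boundary condition, arbitrary pair parameters `w ∈ [0,1]^{Sym2 V}`, any finite vertex type):

  `φ(a|b|c) · φ(abc ∧ a pivotal) ≤ φ(ac|b) · φ(ab|c)`       (`bhkRow_rcMeasureW`),

"`a` pivotal" = `b ≁ c` in the configuration with the pairs at `a` deleted.  The input is the split-vertex form of
van den Berg–Häggström–Kahn's Thm. 1.4 / 2.1 (`Literature/Probability/Percolation/TwoSetConditionalAssociationRCSplitVertex.lean`,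
this gen): given `{b ↮ c off a}`, the clusters of `b` and `c` in the graph with `a` split into leaves are negatively
correlated under `φ`, `q ≥ 1`; for the increasing events "the split cluster has a port at `a`" (= `{a ↔ b}`, `{a ↔ c}`,
`exists_mem_splitCl_iff_reachable`) and the cell decomposition `{b ↮ c off a} = (a|b|c) ⊔ (ac|b) ⊔ (ab|c) ⊔ (abc, a pivotal)`
this reads `(Q + U_b + U_c + T_a)·T_a ≤ (U_c + T_a)·(U_b + T_a)`, i.e. the row.  At `q = 1` the configuration at `a` is
independent of `G − a` and the row is vdBHK's Thm. 1.4 on `G − a`; for `q > 1` that independence fails and no printed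
inequality contains the row (KCLUSTER-gen46 §3.2).  [cite: VandenbergHaggstromKahn2005, Thm. 1.4 (p. 7), Thm. 2.1 (p. 9)]
-/

noncomputable section

namespace Summit.CriticalPhenomena.PercolationContinuityZ3.Theorems

namespace PivotalBHK

open Literature.Probability.Percolation Literature.Probability.Percolation.BHK2006
open MeasureTheory Literature.Probability.LatticeModels SimpleGraph
open scoped Classical

variable {V : Type*}

/-- **An open path that cannot reach `a` avoids `a`**: if `b ↔ c` in `ω` and `b ↮ a`, then `b ↔ c` in
the configuration `ω − a` with the pairs at `a` deleted. [folklore] -/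
theorem reachable_delVertex_of_not_reachable {ω : BondConfig V} {a b c : V}
    (hbc : (openGraph ω).Reachable b c) (hba : ¬ (openGraph ω).Reachable b a) :
    (openGraph (delVertex a ω)).Reachable b c := by
  rw [SimpleGraph.reachable_iff_reflTransGen] at hbc
  induction hbc with
  | refl => exact Reachable.refl b
  | @tail x y hbx hxy ih =>
    obtain ⟨hω, hne⟩ := (openGraph_adj ω x y).1 hxy
    have hbx' : (openGraph ω).Reachable b x := (SimpleGraph.reachable_iff_reflTransGen b x).2 hbx
    have hxa : x ≠ a := by rintro rfl; exact hba hbx'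
    have hya : y ≠ a := by rintro rfl; exact hba (hbx'.trans hxy.reachable)
    exact ih.trans (Adj.reachable ((openGraph_delVertex_adj a ω x y).2 ⟨hω, hxa, hya, hne⟩))

/-- **The split cluster of `b` has a port at `a` iff `a ↔ b`** (`a ≠ b`): some edge of `C^a_{{b}}`
contains `a` iff `a` and `b` are joined by an open path (stop the path at its first visit to `a`).
[folklore] -/
theorem exists_mem_splitCl_iff_reachable {a b : V} (hab : a ≠ b) (ω : BondConfig V) :
    (∃ e ∈ splitCl a ω {b}, a ∈ e) ↔ (openGraph ω).Reachable a b := by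
  have hb : a ∉ ({b} : Set V) := fun h => hab (Set.mem_singleton_iff.1 h)
  constructor
  · rintro ⟨e, ⟨he, hd, u, hu, s, hs, hsu⟩, hae⟩
    rw [Set.mem_singleton_iff] at hs
    subst hs
    have hua : u ≠ a := ne_of_splitReach hb ⟨s, rfl, hsu⟩
    have heq : e = s(u, a) := (Sym2.mem_and_mem_iff hua).1 ⟨hu, hae⟩
    have hsu' : (openGraph ω).Reachable s u := hsu.mono (openGraph_le (delVertex_subset a ω))
    have hadj : (openGraph ω).Adj u a := (openGraph_adj ω u a).2 ⟨heq ▸ he, hua⟩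
    exact (hsu'.trans hadj.reachable).symm
  · intro h
    have h' : (openGraph ω).Reachable b a := h.symm
    rw [SimpleGraph.reachable_iff_reflTransGen] at h'
    -- along an open path from `b`: either the path so far avoids `a`, or a port has been found
    have key : ∀ x, Relation.ReflTransGen (openGraph ω).Adj b x →
        (openGraph (delVertex a ω)).Reachable b x ∨ ∃ e ∈ splitCl a ω {b}, a ∈ e := by
      intro x hx
      induction hx with
      | refl => exact Or.inl (Reachable.refl b)
      | @tail x y _ hxy ih =>
        rcases ih with ih | ih
        · obtain ⟨hω, hne⟩ := (openGraph_adj ω x y).1 hxy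
          have hxa : x ≠ a := ne_of_splitReach hb ⟨b, rfl, ih⟩
          by_cases hya : y = a
          · subst hya
            exact Or.inr ⟨s(x, y), ⟨hω, by rwa [Sym2.mk_isDiag_iff], x, Sym2.mem_mk_left x y,
              b, rfl, ih⟩, Sym2.mem_mk_right x y⟩
          · exact Or.inl (ih.trans (Adj.reachable
              ((openGraph_delVertex_adj a ω x y).2 ⟨hω, hxa, hya, hne⟩)))
        · exact Or.inr ih
    rcases key a h' with h1 | h1
    · exact absurd (eq_of_reachable_delVertex h1) (Ne.symm hab)
    · exact h1

/-- The port event of the split cluster of `b` is the connection event `{a ↔ b}`. [folklore] -/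
theorem setOf_exists_mem_splitCl_eq_openConn {a b : V} (hab : a ≠ b) :
    {ω : BondConfig V | ∃ e ∈ splitCl a ω {b}, a ∈ e} = openConn a b :=
  Set.ext fun ω => exists_mem_splitCl_iff_reachable hab ω

variable [Fintype V]

/-- **The BHK row for the random-cluster measure `φ_{𝐩,q}`, every `q ≥ 1`** (measure form, the
`φ_{𝐩,q}`-version of `bhkRow_prodBernoulli`): for distinct `a ∉ {b, c}` and `φ = rcMeasureW w q ∅`,
`φ(a|b|c) · φ(abc ∧ a pivotal) ≤ φ(ac|b) · φ(ab|c)`, where "`a` pivotal" = `b ≁ c` in the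
configuration with the pairs at `a` deleted.  PROOF: the event form of van den Berg–Häggström–Kahn's
Thm. 1.4 for the clusters of `b` and `c` with `a` SPLIT INTO LEAVES
(`BHK2006_twoSetConditionalAssociation_rc_splitVertex_negCorrelation_events`, `S = {b}`, `T = {c}`,
increasing events "the split cluster has a port at `a`" = `{a ↔ b}`, `{a ↔ c}`), read on the cells:
`{b ↮ c off a} = (a|b|c) ⊔ (ac|b) ⊔ (ab|c) ⊔ (abc, a pivotal)`, so Thm. 1.4 says
`(Q + U_b + U_c + T_a) · T_a ≤ (U_c + T_a)(U_b + T_a)`, i.e. `Q · T_a ≤ U_b · U_c`.  At `q = 1` this is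
vdBHK's Thm. 1.4 on `G − a` (`bhkRow_prodBernoulli`); for `q > 1` the pairs at `a` are not
independent of `G − a`, and the split-vertex form of Thm. 1.4 is what replaces that independence.
[cite: VandenbergHaggstromKahn2005, Thm. 1.4 (p. 7), Thm. 2.1 (p. 9)] -/
theorem bhkRow_rcMeasureW (w : Sym2 V → unitInterval) {q : ℝ} (hq : 1 ≤ q) {a b c : V}
    (hab : a ≠ b) (hac : a ≠ c) :
    (rcMeasureW w q ∅).real ((openConn a b)ᶜ ∩ (openConn a c)ᶜ ∩ (openConn b c)ᶜ) *
        (rcMeasureW w q ∅).real {ω : BondConfig V | ω ∈ openConn a b ∧ ω ∈ openConn a c ∧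
          {e | e ∈ ω ∧ a ∉ e} ∉ openConn b c} ≤
      (rcMeasureW w q ∅).real (openConn a c ∩ (openConn a b)ᶜ) *
        (rcMeasureW w q ∅).real (openConn a b ∩ (openConn a c)ᶜ) := by
  have hq0 : 0 < q := one_pos.trans_le hq
  haveI := isProbabilityMeasure_rcMeasureW w hq0 ∅
  have hbS : a ∉ ({b} : Set V) := fun h => hab (Set.mem_singleton_iff.1 h)
  have hcT : a ∉ ({c} : Set V) := fun h => hac (Set.mem_singleton_iff.1 h)
  -- Thm. 1.4 for the split clusters of `b` and `c`, for the port events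
  have key := BHK2006_twoSetConditionalAssociation_rc_splitVertex_negCorrelation_events w hq hbS hcT
    (fun C => ∃ e ∈ C, a ∈ e) (fun C => ∃ e ∈ C, a ∈ e)
    (fun C C' hCC' ⟨e, he, hae⟩ => ⟨e, hCC' he, hae⟩)
    (fun C C' hCC' ⟨e, he, hae⟩ => ⟨e, hCC' he, hae⟩)
  set μ := rcMeasureW w q ∅ with hμ
  -- the events
  set D : Set (BondConfig V) :=
    {ω | ∀ s ∈ ({b} : Set V), ∀ t ∈ ({c} : Set V), ¬ (openGraph (delVertex a ω)).Reachable s t}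
    with hD
  have hDmem : ∀ ω, ω ∈ D ↔ ¬ (openGraph (delVertex a ω)).Reachable b c := fun ω => by
    simp only [hD, Set.mem_singleton_iff, Set.mem_setOf_eq, forall_eq]
  have hAb : {ω : BondConfig V | ∃ e ∈ splitCl a ω {b}, a ∈ e} = openConn a b :=
    setOf_exists_mem_splitCl_eq_openConn hab
  have hAc : {ω : BondConfig V | ∃ e ∈ splitCl a ω {c}, a ∈ e} = openConn a c :=
    setOf_exists_mem_splitCl_eq_openConn hac
  rw [hAb, hAc] at key
  set Tset : Set (BondConfig V) := {ω | ω ∈ openConn a b ∧ ω ∈ openConn a c ∧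
    {e | e ∈ ω ∧ a ∉ e} ∉ openConn b c} with hTset
  set Q : Set (BondConfig V) := (openConn a b)ᶜ ∩ (openConn a c)ᶜ ∩ (openConn b c)ᶜ with hQ
  set Ub : Set (BondConfig V) := openConn a c ∩ (openConn a b)ᶜ with hUb
  set Uc : Set (BondConfig V) := openConn a b ∩ (openConn a c)ᶜ with hUc
  have hco : ∀ (ω : BondConfig V) (x y : V), ω ∈ openConn x y ↔ (openGraph ω).Reachable x y :=
    fun _ _ _ => Iff.rfl
  -- `U_c ⊆ D`, `U_b ⊆ D`: if `a ↔ b` and `a ↮ c` then `b ↮ c` (even off `a`)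
  have hUcD : Uc ⊆ D := by
    rintro ω ⟨h1, h2⟩
    rw [hDmem]
    intro h
    exact h2 ((show (openGraph ω).Reachable a b from h1).trans
      (h.mono (openGraph_le (delVertex_subset a ω))))
  have hUbD : Ub ⊆ D := by
    rintro ω ⟨h1, h2⟩
    rw [hDmem]
    intro h
    exact h2 ((show (openGraph ω).Reachable a c from h1).trans
      (h.mono (openGraph_le (delVertex_subset a ω))).symm)
  -- (1) `D ∩ ({a↔b} ∩ {a↔c}) = T_a`
  have e1 : D ∩ (openConn a b ∩ openConn a c) = Tset := by
    ext ω
    simp only [Set.mem_inter_iff, hDmem, hTset, Set.mem_setOf_eq]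
    constructor
    · rintro ⟨h, h1, h2⟩; exact ⟨h1, h2, h⟩
    · rintro ⟨h1, h2, h⟩; exact ⟨h, h1, h2⟩
  -- (2) `D ∩ {a↔b} = U_c ⊔ T_a`, (3) `D ∩ {a↔c} = U_b ⊔ T_a`
  have e2 : D ∩ openConn a b = Uc ∪ Tset := by
    ext ω
    simp only [Set.mem_inter_iff, Set.mem_union, hDmem, hTset, hUc, Set.mem_setOf_eq,
      Set.mem_compl_iff]
    constructor
    · rintro ⟨h, h1⟩
      by_cases h2 : ω ∈ openConn a c
      · exact Or.inr ⟨h1, h2, h⟩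
      · exact Or.inl ⟨h1, h2⟩
    · rintro (⟨h1, h2⟩ | ⟨h1, h2, h⟩)
      · exact ⟨(hDmem ω).1 (hUcD ⟨h1, h2⟩), h1⟩
      · exact ⟨h, h1⟩
  have e3 : D ∩ openConn a c = Ub ∪ Tset := by
    ext ω
    simp only [Set.mem_inter_iff, Set.mem_union, hDmem, hTset, hUb, Set.mem_setOf_eq,
      Set.mem_compl_iff]
    constructor
    · rintro ⟨h, h1⟩
      by_cases h2 : ω ∈ openConn a b
      · exact Or.inr ⟨h2, h1, h⟩
      · exact Or.inl ⟨h1, h2⟩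
    · rintro (⟨h1, h2⟩ | ⟨h1, h2, h⟩)
      · exact ⟨(hDmem ω).1 (hUbD ⟨h1, h2⟩), h1⟩
      · exact ⟨h, h2⟩
  -- (4) `D ∖ {a↔b} = U_b ⊔ Q`
  have e4 : D \ openConn a b = Ub ∪ Q := by
    ext ω
    simp only [Set.mem_sdiff, Set.mem_union, hDmem, hUb, hQ, Set.mem_inter_iff, Set.mem_compl_iff]
    constructor
    · rintro ⟨h, h1⟩
      by_cases h2 : ω ∈ openConn a c
      · exact Or.inl ⟨h2, h1⟩
      · refine Or.inr ⟨⟨h1, h2⟩, fun h3 => h ?_⟩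
        exact reachable_delVertex_of_not_reachable h3 fun h4 => h1 ((hco ω a b).2 h4.symm)
    · rintro (⟨h1, h2⟩ | ⟨⟨h1, h2⟩, h3⟩)
      · exact ⟨(hDmem ω).1 (hUbD ⟨h1, h2⟩), h2⟩
      · refine ⟨fun h => h3 ?_, h1⟩
        exact h.mono (openGraph_le (delVertex_subset a ω))
  -- disjointness
  have d2 : Disjoint Uc Tset := Set.disjoint_left.2 fun ω h1 h2 => h1.2 h2.2.1
  have d3 : Disjoint Ub Tset := Set.disjoint_left.2 fun ω h1 h2 => h1.2 h2.1
  have d4 : Disjoint Ub Q := Set.disjoint_left.2 fun ω h1 h2 => h2.1.2 h1.1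
  -- measures
  have m2 : μ.real (D ∩ openConn a b) = μ.real Uc + μ.real Tset := by
    rw [e2]; exact measureReal_union d2 (MeasurableSet.of_discrete)
  have m3 : μ.real (D ∩ openConn a c) = μ.real Ub + μ.real Tset := by
    rw [e3]; exact measureReal_union d3 (MeasurableSet.of_discrete)
  have m4 : μ.real D = μ.real Uc + μ.real Tset + (μ.real Ub + μ.real Q) := by
    rw [← measureReal_inter_add_sdiff (MeasurableSet.of_discrete (s := openConn a b)), m2, e4,
      measureReal_union d4 (MeasurableSet.of_discrete)]
  rw [e1, m2, m3, m4] at key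
  have hT : 0 ≤ μ.real Tset := measureReal_nonneg
  have hUb0 : 0 ≤ μ.real Ub := measureReal_nonneg
  have hUc0 : 0 ≤ μ.real Uc := measureReal_nonneg
  have hQ0 : 0 ≤ μ.real Q := measureReal_nonneg
  nlinarith [key]

end PivotalBHK

end Summit.CriticalPhenomena.PercolationContinuityZ3.Theorems

end
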